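import Summits.QuantumFields.BalabanUV.T4Continuum.Support.NE9CurOfTowerPiChartEndLatticeUniformW80VJ
import Summits.QuantumFields.BalabanUV.T4Continuum.Support.NE9CurChartTowerPiLatticeUniformClassW80VJDelta

/-!
# NE9CurOfTowerPiChartEndLatticeUniformW80VJDelta — THE NE9 END (T25: `T4OutputRate.NE9` ∧ `FadingMemory` of `compCur`) AT THE LATTICE-UNIFORM k-LEVEL
# `cur U` CHART OF PRINT's OPERATOR (3.122) ON PRINT's SMALL-FIELD CLASS — AT THE CHART WITH NO DISPLAYED W-LETTER: (I-10-W80VJ)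
# `Support/NE9CurOfTowerPiChartEndLatticeUniformW80VJ` VERBATIM with its chart supplier replaced by this seat's
# `Support/NE9CurChartTowerPiLatticeUniformClassW80VJDelta` (the (L3) slot `W80 (rieszτ φ) τ U H̃_{1,k} C_k ε_C (Jcur U) Δ_π` with the CONCRETE
# `Δ_π := currentCLM φ lev₁ (∇^η_U) (Δ̃_{a,k} − Q_k†aQ_k)`, print's `Δ_π + DRD*` of [Balaban1985Variational] (87)–(88); NO `(Δ_π, M_Δ)` binder); cell
# `pub-balaban`, T4-DAG §2 node U3 ∕ §6 NE9, WALL-NE9-P1 §3 (ii)∕(vii); NE9 crux-team (2) leaf prover 01 (`b2b-balaban-t4-ne9-formalise-leaf-01`, gen 98);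
# INTERFACE REQUEST NE9 [NE9LEAF01-G98-IFR] (HOME/INBOX.md; ruling e34b3e0c (0)); nothing printed asserted

HONEST FRAMING (T4-DAG PAGE 1).  Rung (B)+1 of the FINITE-VOLUME T⁴ programme — NOT infinite volume, NOT a mass gap, NOT the Clay problem.  NE9
(`T4OutputRate.NE9` ∧ `FadingMemory`) is a cell NEW ESTIMATE, NOT PRINTED in [I] = [Balaban1987RG1] (CMP **109**) ∕ [II] = [Balaban1988RG2Cluster]
(CMP **116**), NOT PROVED here («NE9 ⇐ the named binders»; spine PROVED 0∕9).  HONEST DEPENDENCY (cell line, verbatim): continuum YM on T⁴ ⇐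
BetaPertH ∧ nine spine estimates (0/9 proved); BetaPertH ⇐ (D1) ∧ (D4) ∧ CAP+tail; G-an2-4 gates asym, D1 and NE2/3/4.

WHAT THIS FILE PROVES (ONE theorem; 0 def, 0 sorry, axioms standard; composition BY NAME).
**`termSize_ne9_and_fadingMemory_compCur_of_towerPi_lattice_uniform_W80VJDelta`** — (I-10-W80VJ) with the chart supplier (I-7-W80VJΔ): `∃ α₁ j₁ ε₄ ε_C R_b R′`
BEFORE the lattice; per lattice `∃ h52 hpos′ hposπ`; then for every reading `(ιr, πr)` into the END's carrier and every `Φ` agreeing with the chart, the END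
`Support/NE9CurOfOneInstanceChartEnd.termSize_ne9_and_fadingMemory_compCur_of_chart` — «NE9 ⇐ the named binders» at the curve datum `Dd.compCur Φ R₁`, the
END-COMP binders displayed verbatim.
DISGUISE TEST: composition of two landed theorems; no inequality of the series proved; NOT the two-background chart, NOT claimed that Bałaban's 𝐇_k ∕ old
terms meet these letters (O-NE9-1; #5 UNRULED); NE9 NOT proved.
References (TYPES ∕ loci only): [Balaban1987RG1] (1.18) p. 252; [Balaban1988RG2Cluster] Lemma 1 (1.36) p. 10, (2.15)–(2.22) pp. 16–17; [Balaban1985BackgroundPropagators]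
(3.119) p. 419, (3.122) p. 420, (3.35)–(3.37) p. 396, Thm 3.13 p. 426; [Balaban1985Variational] (27) p. 282, (80) p. 290, (87)–(88) p. 291, Prop. 4 (97)–(98)
p. 293, (103) p. 293, Prop. 6 (117)–(121) p. 295.
-/

noncomputable section

namespace Summit.QuantumFields.BalabanUV.T4Continuum.NE9CurOfTowerPiChartEndLatticeUniformW80VJDelta

open scoped BigOperators InnerProductSpace ComplexConjugate
open Metric Set
open Literature.MathematicalPhysics.QuantumFieldTheory.Balaban1983to89
open Literature.MathematicalPhysics.QuantumFieldTheory.Balaban1983to89.T4OutputRate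
open Literature.MathematicalPhysics.QuantumFieldTheory.Balaban1983to89.T4HistoryLipschitzRecursion
open Literature.MathematicalPhysics.QuantumFieldTheory.Balaban1983to89.T4HistoryLipschitzOuter
open Literature.MathematicalPhysics.QuantumFieldTheory.Balaban1983to89.T4HistoryLipschitzActivity
open Literature.MathematicalPhysics.QuantumFieldTheory.Balaban1983to89.T4HistoryLipschitzActivity (ClusterGeom)
open Literature.MathematicalPhysics.QuantumFieldTheory.Balaban1983to89.T4HistoryLipschitzSegment
open Summit.QuantumFields.BalabanUV.T4Continuum.NE9Lemma1Counting
open Summit.QuantumFields.BalabanUV.T4Continuum.NE9Lemma1Gain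
open Summit.QuantumFields.BalabanUV.T4Continuum.NE9Lemma1PieceClass
open Summit.QuantumFields.BalabanUV.T4Continuum.NE9Lemma1RemainderSpecies
open Summit.QuantumFields.BalabanUV.T4Continuum.NE9Lemma1CurveSpecies
open Summit.QuantumFields.BalabanUV.T4Continuum.NE9ComplexEncoding (doubleCarriers)
open Summit.QuantumFields.BalabanUV.T4Continuum.NE9LastCouplingBridge
open Summit.QuantumFields.BalabanUV.T4Continuum.NE9BridgeSizeInduction
open Summit.QuantumFields.BalabanUV.T4Continuum.NE9MarginalProjection
open Summit.QuantumFields.BalabanUV.T4Continuum.NE9MarginalProjectionEnd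
open Summit.QuantumFields.BalabanUV.T4Continuum.NE9CurveFromBackgroundMap
open Summit.QuantumFields.BalabanUV.T4Continuum.NE9CurveFromBackgroundMapEnd (termSize_ne9_and_fadingMemory_compCur_margProj_cpieceForm)
open Summit.QuantumFields.BalabanUV.T4Continuum.NE9CurOfB11Chart (triple_read)
open B11Eq103H1Complex B11Eq115Space B11Eq174Chart
open B11Eq103H1Complex B11Eq115Space B11Eq174Chart
open B11Eq111FrakG (nabla115)
open B13Contraction113 (QuadAnalytic)
open B9SectCLatticeCarrier (Bond bpos btgt unshift)
open B4Sect5Torus (TSite)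
open B7Prop1Explicit (U1 Wcx boxVec)
open B7Prop2Explicit (pdev AvgClosed C0 c2' unitaryUnits avgClosed_unitaryUnits unitaryUnits_le_U1)
open B7Prop3Flat (c3)
open B9Eq315QTorus (perCfg cornerSite)
open B9Eq315QTower (towerP UlevOf)
open B9Eq326OperatorTower (QkW QkW_surjective laplaceAk)
open B9Eq310HessianOperator (adTransportW)
open B9Eq310DeltaPrime (plaqHolU)
open B9Eq324DeltaPrimeATower (laplacePrimeAk)
open B9Eq3119DeltaPiTower (laplaceAkPi)
open B11Eq44COperatorTower (αT αT_le ulev_mem_U1_of_pdev)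
open B11Eq44COperatorTowerGeometric (ulev_reg_of_pdev_geometric geomProfile_nonneg geomProfile_le_αT sum_geomProfile_le)
open B11Eq44CLetterTower (Cck)
open B9Thm311SmallFieldClosed (hRS_of_unitary)
open B9Eq315QTorusOnto (liftSite perSite_liftSite)
open B7Eq43AveragedSmallnessLevelFree (pdev_perCfg_le_of_plaq)
open B7Eq43AveragedSmallnessLinearFeed (twoWindows_linear_feed)
open B9Thm311SitePrimeFormCoerciveTowerCanonical (exists_strong_site_coercive_tower_diagonal)
open B9Thm311LaplaceAkPiPositiveDiagonal (exists_laplaceAkPi_pos_diagonal_closed)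
open B9Thm311LaplaceAkPositiveDiagonal (exists_laplaceAk_pos_diagonal_closed)
open B9Eq326OperatorTowerRealityUnitary (UlevOf_star_eq_inv forall_star_eq_inv_of_mem)
open B9Eq342GreenPrimeSupBound (norm_adTransportW_eq)
open Summit.QuantumFields.BalabanUV.T4Continuum.NE9CurChartTowerPiLatticeUniformClassW80VJDelta
  (cur_chart_exists_tower_pi_of_unitary_class_lattice_uniform_W80VJDelta)
open B9Eq3119DeltaPiCarrier (currentCLM)
open B11Eq98V0primeCurrentSlots (rieszτ)
open B11Eq98CurrentSlot (Jcur)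
open B11Eq80Current (W80)
open B11Eq63V0GroupCurrent (curV0)
open B11Eq44CLetterTower (Cck)
open Summit.QuantumFields.BalabanUV.T4Continuum.NE9CurOfOneInstanceChartEnd (termSize_ne9_and_fadingMemory_compCur_of_chart)

variable {C₀ : Carriers} {E : Type} [NormedAddCommGroup E] [NormedSpace ℂ E] {ι' αι β γ δ : Type} [DecidableEq δ]

variable (G : ClusterGeom (doubleCarriers C₀)) {Pot : Type*} [NormedAddCommGroup Pot] [NormedSpace ℂ Pot]

variable {d : ℕ} (hd : 1 ≤ d) (L : ℕ) [NeZero L] (hL : 1 ≤ L) (hL2 : 2 ≤ L) (hL3 : 3 ≤ L) [Fact (0 < (L : ℝ))]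
  {𝔸 : Type*} [CStarAlgebra 𝔸] [Nontrivial 𝔸] [FiniteDimensional ℂ 𝔸]
  {W : Type*} [NormedAddCommGroup W] [InnerProductSpace ℂ W] [FiniteDimensional ℂ W] (φ : W ≃ₗ[ℂ] 𝔸)
  {Mφ Mφ' : ℝ} (hMφ : 0 ≤ Mφ) (hMφ' : 0 ≤ Mφ') (hφ : ∀ w, ‖φ w‖ ≤ Mφ * ‖w‖) (hφ' : ∀ X, ‖φ.symm X‖ ≤ Mφ' * ‖X‖)
  {a : ℝ} (ha : 0 < a) {a' : ℝ} (ha' : 0 < a')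
  (τ : 𝔸 →ₗ[ℂ] ℂ) {Cτ : ℝ} (hτ : ∀ X, ‖τ X‖ ≤ Cτ * ‖X‖) (hCτ : 0 ≤ Cτ) {Mτ : ℝ} (hτm : ∀ X Y : 𝔸, ‖τ (X * Y)‖ ≤ Mτ * ‖X‖ * ‖Y‖) (hMτ : 0 ≤ Mτ)
  {ρw : ℝ} (hρw : 0 ≤ ρw)
  (hτ₁ : ∀ X : 𝔸, τ (star X) = conj (τ X)) (hτ₂ : ∀ X Y : 𝔸, τ (X * Y) = τ (Y * X)) (hφτ : ∀ X Y : 𝔸, ⟪φ.symm X, φ.symm Y⟫_ℂ = τ (star X * Y))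
  {α₀ : ℝ} (hα₀ : 0 < α₀) (hα3 : C0 d * α₀ ≤ 1 / 3) (hα4 : 4 * α₀ ≤ c2' d L)
  (hαL : 50 * (d + 1) * αT d L α₀ * (L : ℝ) ^ d ≤ 1 / 2)
  {ρ : ℝ} (hρ0 : 0 < ρ) (hρ : Real.exp (4 * (800 * ((d : ℝ) + 1) ^ 2 * ((d : ℝ) + 4)) * α₀) * (1 + 8 * (131072 * ((d : ℝ) + 1) ^ 2) * ρ) ≤ 2)
  (hρ4 : 4 * ρ ≤ c3 d L) (hθ : 2 * d * B7Prop5GeneralLevels.thetaGen d L α₀ ≤ (L : ℝ) ^ 3 / 16) (hC3 : 2 * d * B7Prop5GeneralLevels.C3Gen d L * ρ ≤ 1)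
  (hCτ1 : Cτ ≤ 1) {ωw Ωw : ℝ} (hωw1 : 1 ≤ ωw) (hΩw1 : 1 ≤ Ωw)

-- deep definitional unfolding `laplaceAkPi` ↦ `laplaceALatticeK … (π†Δπ) …` in the statement (as the host)
set_option maxRecDepth 8192 in
set_option maxHeartbeats 3200000 in -- (I-7)'s ≈ 60-binder theorem + END-COMP's ≈ 50 binders, applied once each (W80VJΔ chart)
include hd hL2 hL3 hMφ hMφ' hφ hφ' ha ha' hτ hCτ hτm hMτ hρw hτ₁ hτ₂ hφτ hα₀ hα3 hα4 hαL hρ0 hρ hρ4 hθ hC3 hCτ1 hωw1 hΩw1 in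
/-- **THE NE9 END AT THE LATTICE-UNIFORM k-LEVEL `cur U` CHART ON PRINT's CLASS, NO W-LETTER DISPLAYED** — (I-7-W80VJΔ) KEPT (`∃` radii before the
lattice, `∃ h52 hpos′ hposπ` per lattice; the (L3) slot at the concrete `Δ_π = currentCLM φ lev₁ (∇^η_U) (Δ̃_{a,k} − Q_k†aQ_k)`), then for every reading
`(ιr, πr)` and every `Φ` agreeing with the chart, the END `termSize_ne9_and_fadingMemory_compCur_of_chart`: `T4OutputRate.NE9 … ∧ FadingMemory …` for
`Dd.compCur Φ R₁` from the displayed END-COMP binders. [folklore]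
[cite: Balaban1987RG1, (1.18) p.252; Balaban1988RG2Cluster, Lemma 1 (1.36) p.10, (2.15)–(2.22) pp.16–17; Balaban1985BackgroundPropagators, (3.119) p.419, (3.122) p.420, (3.35)–(3.37) p.396, Thm 3.13 p.426; Balaban1985Variational, (87)–(88) p.291, (103) p.293, Prop. 6 (117)–(121) p.295, (172)–(175) p.305] -/
theorem termSize_ne9_and_fadingMemory_compCur_of_towerPi_lattice_uniform_W80VJDelta
    -- END-COMP's binders NOT mentioning the curve datum, verbatim (bound names as in (C′) ∕ (C″))
    {Dd : RemData C₀ E ι' αι β γ δ} {R₁ : C₀.Dom → ℝ} {ℓg : ℕ → ℕ → ℝ} {cdir d0 : ℝ}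
    {Ef : Functional (doubleCarriers C₀) E} {Wd : Set (ℕ → ℝ)} {Adm S : Set (E → (doubleCarriers C₀).Dom → ℝ)}
    {r : ℕ → (E → (doubleCarriers C₀).Dom → ℝ) → ℝ} {A : E → (doubleCarriers C₀).Dom → ℝ}
    {ΨF : ℕ → ℝ → (ι' → ℝ) → E → (doubleCarriers C₀).Dom → ℝ} {act : ℕ → ℝ → E → Pot → G.P → ℂ} {𝒜 : ℕ → Set Pot}
    {n : ℕ → ℝ → E → G.P → ℝ} {lip clip : ℕ → ℝ} {aP dP : G.P → ℝ} {δv : (doubleCarriers C₀).Dom → ℝ}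
    {κw O1 cQ ω clipd Nbar B lipbar clipbar cr aA : ℝ} {p₀ N : ℕ → ℝ}
    (ρP : ℕ → (ι' → ℝ) → Pot) (U₀ : E) (explZ : ℕ → E → (doubleCarriers C₀).Dom → ℝ) (h0 : ScaleZeroFree Ef Wd)
    (hAdm : AdmissibleTerms Ef Wd Adm) (hres : AdmRestrict Adm)
    (hDd : Dd.Admissible ℓg cdir d0) (hdirB0 : ∀ k s y a' b x, 0 < Dd.dirB k s y a' b x)
    (hdirC : ∀ k s y a' b x, Continuous fun p : ℂ × (δ → ℝ) × (δ → ℂ) => Dd.dir k s y a' b x p.1 p.2.1 p.2.2)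
    (hdirB : ∀ k s y a' b x t s' σ', ‖Dd.dir k s y a' b x t s' σ'‖ ≤ Dd.dirB k s y a' b x)
    (hrA : ReadAdditive Adm r) (hr0 : ReadZero r) (hrs : ReadSize Adm r κw cr) (hA : DirSize A κw aA) (hcr : 0 ≤ cr)
    (haA : 0 ≤ aA)
    (hAmul : ∀ c : ℕ → ℝ, (fun U X' => c ((doubleCarriers C₀).scale X') * A U X') ∈ Adm)
    (hcoef : ∀ (j : ℕ) (c : ℝ), r j (restrictScale j (c • A)) = c * r j (restrictScale j A))
    (hnorm : ∀ j : ℕ, r j (restrictScale j A) = 1 ∨ ∀ H ∈ Adm, r j (restrictScale j H) = 0)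
    (hS : ∀ H ∈ Adm, margProj r A H ∈ S)
    (hclipd : 0 ≤ clipd) (hcdir : 0 < cdir) (hℓpos : ∀ k j, 0 < ℓg k j) (hhalf : ∀ k j, cdir * ℓg k j < 1 / 2)
    (hcont : ∀ (k : ℕ) (s : ℕ → ℝ) (y : ι') (a' : αι) (b : β) (x : (doubleCarriers C₀).Dom),
      ContinuousOn (fun p : ℂ × ((δ → ℝ) × (δ → ℂ)) => Dd.dir k s y a' b x p.1 p.2.1 p.2.2)
        (sphere (0:ℂ) (Dd.r k) ×ˢ {q | OnContour Dd.κ₁ (Dd.cubes k y a' b) q.1 q.2}))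
    (hlip : ∀ g ∈ Wd, ∀ g' ∈ Wd, ∀ (k : ℕ) (y : ι'), ∀ a' ∈ Dd.S0 k y, ∀ b ∈ Dd.SY k y a', ∀ (j : ℕ), ∀ x ∈ Dd.src k y a' j,
      ∀ t ∈ sphere (0:ℂ) (Dd.r k), ∀ (s' : δ → ℝ) (σ' : δ → ℂ), OnContour Dd.κ₁ (Dd.cubes k y a' b) s' σ' →
        ‖Dd.dir k g y a' b x t s' σ' - Dd.dir k g' y a' b x t s' σ'‖ ≤ clipd * (cdir * ℓg k j * Dd.R x.1) * |g k - g' k|)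
    (hO1 : 0 ≤ O1) (hcQ : 0 ≤ cQ) (hω0 : 0 ≤ ω) (hω1 : ω < 1) (hNb : ∀ j, N j ≤ Nbar) (hclip0 : ∀ k, 0 ≤ clip k)
    (hCup : ∀ g ∈ Wd, ∀ g' ∈ Wd, ∀ (k : ℕ) (Ue : E) (X : (doubleCarriers C₀).Dom), (doubleCarriers C₀).scale X = k + 1 →
      ∀ Q ∈ 𝒜 k, ∀ γ' ∈ G.vol X,
      ‖act k (g k) Ue Q γ'‖ ≤ n k (g' k) Ue γ' ∧
        ‖act k (g k) Ue Q γ' - act k (g' k) Ue Q γ'‖ ≤ clip k * |g k - g' k| * n k (g' k) Ue γ')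
    (hreprV : ∀ (k : ℕ) (s : ℝ) (Q : ι' → ℝ) (Ue : E) (X : (doubleCarriers C₀).Dom),
      ΨF k s Q Ue X = (G.newTerm act k s Ue X (ρP k Q)).re - (G.newTerm act k s U₀ X (ρP k Q)).re + explZ k Ue X)
    (hclipb : ∀ k, clip k ≤ clipbar)
    (hK : TwoPointKP G Wd act 𝒜 n lip aP dP) (hdec : G.DecayExtract δv dP) (hpin : G.PinBudget aP δv (fun _ => B) κw)
    (hexplZ : ∀ (k : ℕ) (Ue : E) (X : (doubleCarriers C₀).Dom), (doubleCarriers C₀).scale X = k + 1 →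
      |explZ k Ue X| ≤ Real.exp (-(κw * (doubleCarriers C₀).d X)) * p₀ k)
    (hbase : ∀ g ∈ Wd, ∀ (Ue : E) (X : (doubleCarriers C₀).Dom), (doubleCarriers C₀).scale X = 0 →
      |Ef g Ue X| ≤ Real.exp (-(κw * (doubleCarriers C₀).d X)) * N 0)
    (hNsucc : ∀ j, p₀ j + 2 * B ≤ N (j + 1)) (hNnn : ∀ j, 0 ≤ N j)
    (hB : 0 ≤ B) (hlipb : ∀ k, lip k ≤ lipbar) (hposω : 0 < ω + 8 * lipbar * B * ((1 + cr * aA) * cQ)) :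
    ∃ α₁ j₁ ε₄ εC Rb R' : ℝ, 0 < α₁ ∧ 0 < j₁ ∧ 0 < Rb ∧ 0 < R' ∧
      ∀ (n : ℕ) (η : ℝ) [Fact (0 < η)] (hηL : η * (L : ℝ) ^ (n + 1) = 1) (c₀ c₁ : ℝ) [Fact (0 < c₀)] [Fact (0 < c₁)]
        (_hw : c₀ * ((L : ℝ) ^ (n + 1)) ^ d = c₁) (_hc₀η : c₀ = η ^ d) (_hρ : |η| ^ d / c₀ ≤ ρw) (m : Fin d → ℕ) [∀ i, NeZero (m i)] (_hm : ∀ i, 1 ≤ m i)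
        (U : Bond d (towerP L m (n + 1)) → 𝔸ˣ) (hUG : ∀ (x : B7Prop1Explicit.Site d) (κ : Fin d), perCfg (towerP L m (n + 1)) U x κ ∈ unitaryUnits 𝔸)
        (α : ℝ) (_hα : 0 ≤ α) (_hαle : α ≤ α₁) (_hUη : ∀ b, ‖(U b : 𝔸) - 1‖ ≤ α * η)
        (_hpl : ∀ p : B9SectCLatticeCarrier.Plaq d (towerP L m (n + 1)), ‖(plaqHolU U p : 𝔸) - 1‖ ≤ α * η ^ 2)
        (_hUgrad : ∀ (x : TSite d (towerP L m (n + 1))) (μ : Fin d), ‖(U (x, μ) : 𝔸) - U (unshift μ x, μ)‖ ≤ α * η ^ 2)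
        (j₀ : ℝ) (_hJ : ∀ μ y, ‖B9Eq39Adjoint.J (fun μ => B9Eq33CovDerivVector.shiftEquiv μ) (fun μ y => U (y, μ)) η μ y‖ ≤ j₀) (_hj : j₀ ≤ j₁)
        (lev₀ : Bond d (towerP L m (n + 1)) → ℕ) (lev₁ : Bond d (towerP L m (n + 1)) × Fin d → ℕ) (levB : Bond d m → ℕ) (_hlev : ∀ b, n + 1 ≤ lev₀ b)
        (_hw₀ : (NegSup.wSup (levWeight (L : ℝ) η lev₀ 1) : ℝ) ≤ ωw) (_hw₁ : (NegSup.wSup (levWeight (L : ℝ) η lev₁ 2) : ℝ) ≤ ωw)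
        (_hw₃ : (NegSup.wInvSup (levWeight (L : ℝ) η lev₀ 3) : ℝ) ≤ Ωw) (_hwB : (NegSup.wInvSup (levWeight (L : ℝ) η levB 0) : ℝ) ≤ Ωw)
        (_hw₁' : (NegSup.wInvSup (levWeight (L : ℝ) η lev₁ 2) : ℝ) ≤ Ωw),
      ∃ h52 : pdev (perCfg (towerP L m (n + 1)) U) < α₀ * (((L : ℝ) ^ (n + 1))⁻¹) ^ 2,
      ∃ hpos' : ∀ x : SiteL2K ℂ d (towerP L m (n + 1)) c₀ W, x ≠ 0 →
          0 < RCLike.re ⟪x, laplacePrimeAk L m n φ η U a' (c₁ := c₁) x⟫_ℂ,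
      ∃ hposπ : ∀ x : BondL2K ℂ d (towerP L m (n + 1)) c₀ W, x ≠ 0 →
          0 < RCLike.re ⟪x, laplaceAkPi L m n φ τ η U a' hpos' hL (fun j => αT d L α₀ * (((L : ℝ) ^ min (j + 1) (n + 1))⁻¹) ^ 2)
            (fun j => (geomProfile_le_αT (d := d) L (n + 1) hL hα₀.le j).trans (αT_le hL hα4))
            (ulev_mem_U1_of_pdev L m (n + 1) U hL2 (avgClosed_unitaryUnits d L) hUG hα₀ hα3 hα4 h52)
            (ulev_reg_of_pdev_geometric L m (n + 1) U hL2 (avgClosed_unitaryUnits d L) hUG hα₀ hα3 hα4 h52) (c₁ := c₁) a x⟫_ℂ,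
      let Hc := H1LatticeCLM (lev₀ := lev₀) (levB := levB) φ hposπ
              (QkW_surjective L m n φ U hL _ _ _ _ fun j => le_trans (mul_le_mul_of_nonneg_right (mul_le_mul_of_nonneg_left
                (geomProfile_le_αT (d := d) L (n + 1) hL hα₀.le j) (by positivity)) (by positivity)) hαL) lev₁ (nabla115 η U)
      let Gc := frakGLatticeCLM (lev₀ := lev₀) φ hposπ
              (QkW_surjective L m n φ U hL _ _ _ _ fun j => le_trans (mul_le_mul_of_nonneg_right (mul_le_mul_of_nonneg_left
                (geomProfile_le_αT (d := d) L (n + 1) hL hα₀.le j) (by positivity)) (by positivity)) hαL) lev₁ (nabla115 η U)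
      let Cx := Cck L m η (n + 1) U lev₀ lev₁ (nabla115 η U) levB
      ∀ (ιr : C₀.Dom → (E →L[ℂ] NegSize (L : ℝ) η levB 0 𝔸)) (πr : C₀.Dom → (Space115 (L : ℝ) η lev₀ lev₁ (nabla115 η U) →L[ℂ] E)),
          (∀ X, MapsTo (ιr X) (ball 0 (Dd.R X)) (ball 0 Rb)) → (∀ X, MapsTo (πr X) (ball 0 R') (ball 0 (R₁ X))) →
          ∀ (Φ : C₀.Dom → E → E), (∀ X e, Φ X e = πr X (chartHB Gc 0 (W80 (rieszτ φ) (LinearMap.toContinuousLinearMap τ) U (H1LatticeCLM (lev₀ := lev₀) (levB := levB) φ hposπ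
              (QkW_surjective L m n φ U hL _ _ _ _ fun j => le_trans (mul_le_mul_of_nonneg_right (mul_le_mul_of_nonneg_left
                (geomProfile_le_αT (d := d) L (n + 1) hL hα₀.le j) (by positivity)) (by positivity)) hαL) lev₁ (nabla115 η U))
              (Cck L m η (n + 1) U lev₀ lev₁ (nabla115 η U) levB) εC (Jcur (L := (L : ℝ)) (η := η) (lev₀ := lev₀) U)
              (currentCLM φ lev₁ (nabla115 η U)
                (laplaceAkPi L m n φ τ η U a' hpos' hL (fun j => αT d L α₀ * (((L : ℝ) ^ min (j + 1) (n + 1))⁻¹) ^ 2)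
                    (fun j => (geomProfile_le_αT (d := d) L (n + 1) hL hα₀.le j).trans (αT_le hL hα4))
                    (ulev_mem_U1_of_pdev L m (n + 1) U hL2 (avgClosed_unitaryUnits d L) hUG hα₀ hα3 hα4 h52)
                    (ulev_reg_of_pdev_geometric L m (n + 1) U hL2 (avgClosed_unitaryUnits d L) hUG hα₀ hα3 hα4 h52) (c₁ := c₁) a
                  - LinearMap.adjoint (QkW L m n φ U hL (fun j => αT d L α₀ * (((L : ℝ) ^ min (j + 1) (n + 1))⁻¹) ^ 2)
                    (fun j => (geomProfile_le_αT (d := d) L (n + 1) hL hα₀.le j).trans (αT_le hL hα4))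
                    (ulev_mem_U1_of_pdev L m (n + 1) U hL2 (avgClosed_unitaryUnits d L) hUG hα₀ hα3 hα4 h52)
                    (ulev_reg_of_pdev_geometric L m (n + 1) U hL2 (avgClosed_unitaryUnits d L) hUG hα₀ hα3 hα4 h52) (c₀ := c₀) (c₁ := c₁)) ∘ₗ
                      ((a : ℂ) • QkW L m n φ U hL (fun j => αT d L α₀ * (((L : ℝ) ^ min (j + 1) (n + 1))⁻¹) ^ 2)
                    (fun j => (geomProfile_le_αT (d := d) L (n + 1) hL hα₀.le j).trans (αT_le hL hα4))
                    (ulev_mem_U1_of_pdev L m (n + 1) U hL2 (avgClosed_unitaryUnits d L) hUG hα₀ hα3 hα4 h52)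
                    (ulev_reg_of_pdev_geometric L m (n + 1) U hL2 (avgClosed_unitaryUnits d L) hUG hα₀ hα3 hα4 h52) (c₀ := c₀) (c₁ := c₁))))) 0 (fun A' => A' + solA Hc 0 Cx 0 εC A') ε₄ Hc (ιr X e))) →
          -- END-COMP's binders that mention the curve datum `Dd.compCur Φ R₁`
          LevelCountsG (Dd.compCur Φ R₁).toC.frame κw (Dd.compCur Φ R₁).κ₁ O1 cQ (fun k j => ℓg k j ^ 5) (agePow ω) →
          Adm ⊆ analyticClass (Dd.compCur Φ R₁).R → A ∈ analyticClass (Dd.compCur Φ R₁).R →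
          Factorises Ef Wd (compProj (cpieceChannel (Dd.compCur Φ R₁).toC) (margProj r A)) ΨF →
          (∀ (k : ℕ) (Q Q' : ι' → ℝ) (M : ℝ),
            (∀ y, |Q y - Q' y| ≤ weightOf (Dd.compCur Φ R₁).toC.frame (Dd.compCur Φ R₁).κ₁ d0 O1 ((Dd.compCur Φ R₁).Kp cdir) k y
              * M) → ‖ρP k Q - ρP k Q'‖ ≤ M) →
          (∀ (k : ℕ) (Q : ι' → ℝ),
            (∀ y, |Q y| ≤ weightOf (Dd.compCur Φ R₁).toC.frame (Dd.compCur Φ R₁).κ₁ d0 O1 ((Dd.compCur Φ R₁).Kp cdir) k y *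
              sizeRadius (fun k j => (1 + cr * aA) * tauOfG cQ (agePow ω) k j) N k) → ρP k Q ∈ 𝒜 k) →
          TermSize Ef Wd κw N ∧
            NE9 Ef Wd κw (prodModuli (8 * clipbar * B + 8 * lipbar * B *
                ((64 * (4 * clipd) * Nbar + cr * Nbar * (64 * (4 * clipd) * aA)) * cQ * (1 - ω)⁻¹))
              fun _ => ω + 8 * lipbar * B * ((1 + cr * aA) * cQ)) ∧
              FadingMemory ((8 * clipbar * B + 8 * lipbar * B *
                    ((64 * (4 * clipd) * Nbar + cr * Nbar * (64 * (4 * clipd) * aA)) * cQ * (1 - ω)⁻¹)) /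
                  (ω + 8 * lipbar * B * ((1 + cr * aA) * cQ)))
                (ω + 8 * lipbar * B * ((1 + cr * aA) * cQ))
                (prodModuli (8 * clipbar * B + 8 * lipbar * B *
                    ((64 * (4 * clipd) * Nbar + cr * Nbar * (64 * (4 * clipd) * aA)) * cQ * (1 - ω)⁻¹))
                  fun _ => ω + 8 * lipbar * B * ((1 + cr * aA) * cQ)) := by
  obtain ⟨α₁, j₁, ε₄, εC, Rb, R', hα₁, hj₁, hRb0, hR'0, HC⟩ :=
    cur_chart_exists_tower_pi_of_unitary_class_lattice_uniform_W80VJDelta hd L hL hL2 hL3 φ hMφ hMφ' hφ hφ' ha ha' τ hτ hCτ hτm hMτ hρw hτ₁ hτ₂ hφτ hα₀ hα3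
      hα4 hαL hρ0 hρ hρ4 hθ hC3 hCτ1 hωw1 hΩw1
  refine ⟨α₁, j₁, ε₄, εC, Rb, R', hα₁, hj₁, hRb0, hR'0, ?_⟩
  intro n η _ hηL c₀ c₁ _ _ hw hc₀η hρ' m _ hm U hUG α hα0 hαle hUη hpl hUgrad j₀ hJ hj' lev₀ lev₁ levB hlev hw₀ hw₁ hw₃ hwB hw₁'
  obtain ⟨h52, hpos', hposπ, hΨ1, hΨ2, hΨ3⟩ :=
    HC n η hηL c₀ c₁ hw hc₀η hρ' m hm U hUG α hα0 hαle hUη hpl hUgrad j₀ hJ hj' lev₀ lev₁ levB hlev hw₀ hw₁ hw₃ hwB hw₁'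
  refine ⟨h52, hpos', hposπ, ?_⟩
  intro Hc Gc Cx ιr πr hιr hπr Φ hΦ hLev hAdmAn hAan hfac hρQ hbox
  exact termSize_ne9_and_fadingMemory_compCur_of_chart G hΨ1 hΨ2 hΨ3 ιr πr hιr hπr hΦ ρP U₀ explZ h0 hAdm hres hDd hdirB0 hdirC
    hdirB hLev hAdmAn hrA hr0 hrs hA hcr haA hAan hAmul hcoef hnorm hS hclipd hcdir hℓpos hhalf hcont hlip hO1 hcQ hω0 hω1 hNb hfac
    hclip0 hCup hreprV hclipb hK hdec hpin hρQ hexplZ hbase hNsucc hNnn hbox hB hlipb hposω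

end Summit.QuantumFields.BalabanUV.T4Continuum.NE9CurOfTowerPiChartEndLatticeUniformW80VJDelta

end
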